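import Literature.AlgebraicGeometry.ComplexMultiplication.CMTorusEndomorphismDescent
import Literature.AlgebraicGeometry.ComplexMultiplication.CMTypeIsogenyInvariance
import Literature.AlgebraicGeometry.HodgeTheory.ComplexTorusLatticeCoordinatesHodge
import Literature.NumberTheory.ComplexMultiplication.CMTypeTorusAbelianVariety
import HarnessLib

/-!
# The CM type of an algebraised CM torus, read on `H^{1,0}`, is `Φ`

Shimura, *Abelian Varieties with Complex Multiplication and Modular Functions* (1998), §6.2
THEOREM 3 (printed pp. 41–42), last clause: the abelian variety `A ≅ ℂⁿ/D(𝔪)` with its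
`K`-action `ι` «is of type `(F; {φ_i})`»; by §5.2 (pp. 38–39: «`δι(α)ω_i = α^{φ_i}ω_i`») the
type is read on the holomorphic one-forms `H^{1,0}(A)`, and by §3.2 (pp. 19–20) the action on
`H¹ = H^{1,0} ⊕ H^{0,1}` is `S ⊕ S̄`.  Lange–Birkenhake, *Complex Abelian Varieties*, §1.1.3
Lemma 1.1.17 / §1.1.5 Thm. 1.1.21: `H¹(X, ℤ) = Hom(Λ, ℤ)`, `H^{1,0}(X) = Hom_ℂ(V, ℂ)`.

For the tree's torus of record `T = ℂ^Φ/D(I)` (`CMTypeLattice.periodIso Φ I`) ALGEBRAISED by an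
abelian variety `A` with analytification `φ : T → A(ℂ)` (a group homomorphism), and the `K`-action
`torusEndAlgebra : K → End⁰(A)` of `CMTorusEndomorphismDescent`, this file proves:

* `coord` (§1) — the canonical lattice coordinates `H¹(A(ℂ); ℚ) ≅ H¹(T; ℚ) ≅ ℚ^ι`
  (`HodgeTheory.latticeCoordHOne`, Lemma 1.1.17), and `coord_hOneAlgHom` (§2): in these
  coordinates `(torusEnd a)^*` is the TRANSPOSE of the rational representation `mulMatrix I a`
  (functoriality of singular cohomology for `φ ∘ ι(a) = (torusEnd a)(ℂ) ∘ φ`, and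
  `latticeCoordHOne_map_mapMatrix`);
* `projRow` (§3) — for `σ ∈ Φ` the period row `(σ(βᵢ))ᵢ ∈ ℂ ⊗_ℚ ℚ^ι` of the `ℂ`-linear
  coordinate functional `z ↦ z_σ` on `ℂ^Φ`: a `(1,0)`-row (`periodRow_mem_hodgeOneZeroRows`),
  non-zero, and a `σ`-eigenrow of every transposed `mulMatrix I a` (`a βᵢ = Σⱼ Mⱼᵢ βⱼ`);
* `exists_eigenvector_one_zero` (§4) — hence a non-zero `σ`-eigenvector of the `K`-action in
  `H^{1,0}(A)`, the Hodge type being read through the kernel theorem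
  `complexTorus_latticeCoordHOne_hodgeOneZero_holds` and `BettiUniverse.mem_hodge_piece_one_zero_iff`;
* **`cmType_eq`** (§5) — `{σ | n_σ = 1} = Φ`, using `n_σ + n_σ̄ = 1`
  (`multiplicity_add_multiplicity_conjugate_eq_one`, as `[K : ℚ] = 2|Φ| = 2 dim A`, `dim_eq_card`);
* **`isCMTypeRealisation`** (§6) — `(A, torusEnd, complexAction torusEndAlgebra)` REALISES the CM
  type `(K; Φ)` on `H¹` (`isCMTypeRealisation_of_principal_of_cmType`; the pair is principal by
  construction), and `exists_isCMTypeRealisation`: the `∃`-clause of the record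
  `PicardCM.CMAbelianVarietyRealised` for `(K, Φ)` holds as soon as the CM torus is algebraised.

Theorems, plus three definitions of DATA (`contMap`, `coord`, `projRow`: plumbing); no named fact,
no `sorry`.  The algebraisation itself (Lefschetz: `isAbelianVariety_periodIso` + theta embedding
of type `D` + Chow/GAGA) lives Summits-side (`CorCM/Model/CMAbelianVarietyRealisedHolds`).

## References
* [Shimura1998] G. Shimura, *Abelian Varieties with Complex Multiplication and Modular Functions*
  (1998), §3.2 (pp. 19–20), §5.2 (pp. 36–39), §6.2 Thm. 3 (pp. 41–42).
* [LangeBirkenhake1992] H. Lange, Ch. Birkenhake, *Complex Abelian Varieties* (1992), §1.1.2,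
  §1.1.3 Lemma 1.1.17, §1.1.5 Thm. 1.1.21.
* [Deligne1982HodgeCycles] P. Deligne, *Hodge cycles on abelian varieties*, LNM 900 (1982),
  Example 3.7, §4.
-/

noncomputable section

open scoped Manifold ContDiff Classical nonZeroDivisors TensorProduct
open CategoryTheory NumberField Module

namespace Literature.AlgebraicGeometry.ComplexMultiplication

open Literature.AlgebraicGeometry.Motives Literature.AlgebraicGeometry.HodgeTheory
open Literature.AlgebraicGeometry.Motives.HodgeStructure
open Literature.Geometry.Kaehler
open Literature.AlgebraicTopology.SingularHomology (singularCohomology)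
open Literature.NumberTheory.Transcendental (IsAnalytification)
open Literature.NumberTheory.ComplexMultiplication
open Literature.NumberTheory.ComplexMultiplication.CMTypeLattice (periodIso mulMatrix basisIndex
  cmEmbedding periodIso_single mul_basis_eq_sum)

namespace CMTorusRealisation

variable {K : Type} [Field K] [NumberField K] (Φ : CMType K) (I : (FractionalIdeal (𝓞 K)⁰ K)ˣ)
  {A : AbelianVariety ℂ} {φ : ComplexTorus (periodIso Φ I) → ComplexPoints A.X}
  (hφ : IsAnalytification (Φ.1 → ℂ) A.X A.dim φ) (hadd : ∀ x y, φ (x + y) = φ x * φ y)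

/-! ### §1 Canonical lattice coordinates on `H¹(A(ℂ); ℚ)` -/

/-- The analytification as a continuous map `T → A(ℂ)`. [folklore] -/
def contMap : C(ComplexTorus (periodIso Φ I), ComplexPoints A.X) := ⟨φ, hφ.isHomeomorph.continuous⟩

/-- `contMap` is `φ`. [folklore] -/
@[simp] private theorem contMap_apply (x : ComplexTorus (periodIso Φ I)) : contMap Φ I hφ x = φ x := rfl

/-- **Canonical lattice coordinates** `H¹(A(ℂ); ℚ) ≅ H¹(T; ℚ) ≅ ℚ^ι = Hom(D(I), ℚ)`: pull back along
the (homeomorphic) analytification, then take the coordinates dual to the lattice basis `(v(βᵢ))`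
(`latticeCoordHOne`). [cite: LangeBirkenhake1992, §1.1.3 Lemma 1.1.17 (a)] -/
def coord : bettiCohomology A.X 1 ≃ₗ[ℚ] (basisIndex I → ℚ) :=
  (singularCohomology.mapIso ℚ ℚ (hφ.isHomeomorph.homeomorph φ) 1).toLinearEquiv.trans
    (latticeCoordHOne (periodIso Φ I))

/-- `coord x = latticeCoordHOne (φ^* x)`. [cite: LangeBirkenhake1992, §1.1.3 Lemma 1.1.17 (a)] -/
theorem coord_apply (x : bettiCohomology A.X 1) :
    coord Φ I hφ x = latticeCoordHOne (periodIso Φ I) (singularCohomology.map ℚ ℚ (contMap Φ I hφ) 1 x) := by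
  have hcoe : ((hφ.isHomeomorph.homeomorph φ : ComplexTorus (periodIso Φ I) ≃ₜ ComplexPoints A.X) :
      C(ComplexTorus (periodIso Φ I), ComplexPoints A.X)) = contMap Φ I hφ :=
    ContinuousMap.ext fun _ => rfl
  change latticeCoordHOne (periodIso Φ I)
    ((singularCohomology.mapIso ℚ ℚ (hφ.isHomeomorph.homeomorph φ) 1).hom x) = _
  rw [singularCohomology.mapIso_hom, hcoe]

/-- `coord` as a composite of linear maps. [cite: LangeBirkenhake1992, §1.1.3 Lemma 1.1.17 (a)] -/
theorem coord_toLinearMap :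
    (coord Φ I hφ).toLinearMap =
      (latticeCoordHOne (periodIso Φ I)).toLinearMap ∘ₗ
        (singularCohomology.map ℚ ℚ (contMap Φ I hφ) 1).hom :=
  LinearMap.ext fun x => coord_apply Φ I hφ x

/-! ### §2 Naturality: `(torusEnd a)^*` in lattice coordinates is `(mulMatrix I a)ᵀ` -/

/-- **The action of `ι(a)` on `H¹(A(ℂ); ℚ)` in canonical lattice coordinates is the transpose of
the rational representation** `mulMatrix I a` (Lange–Birkenhake §1.1.2–1.1.3: a homomorphism with
rational representation `R` acts on `H¹ = Hom(Λ, ℤ)` by `Rᵀ`; here through the analytification,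
by functoriality of singular cohomology for `φ ∘ ι(a) = (torusEnd a)(ℂ) ∘ φ`).
[cite: LangeBirkenhake1992, §1.1.2 eq. (1.2) and §1.1.3 Lemma 1.1.17 (a)]
[cite: Shimura1998, §3.2 (pp. 19–20)] -/
theorem coord_hOneAlgHom (a : 𝓞 K) (x : bettiCohomology A.X 1) :
    coord Φ I hφ (hOneAlgHom (torusEndAlgebra Φ I hφ hadd) (a : K) x) =
      ((mulMatrix I a).transpose.map (Int.cast : ℤ → ℚ)).mulVec (coord Φ I hφ x) := by
  -- `(ι a)^* = (torusEnd a)^*`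
  have h1 : hOneAlgHom (torusEndAlgebra Φ I hφ hadd) (a : K) x =
      bettiCohomology.map (torusEnd Φ I hφ hadd a).hom.hom.hom 1 x := by
    rw [hOneAlgHom_apply, torusEndAlgebra_algebraMap, bettiRep_of, MulOpposite.unop_op]
  -- functoriality square
  let fM : C(ComplexTorus (periodIso Φ I), ComplexTorus (periodIso Φ I)) :=
    ⟨torusMap Φ I a, (mdifferentiable_torusMap Φ I a).continuous⟩
  have hcomm : (contMap Φ I hφ).comp fM =
      (AlgPoints.mapContinuous (L := ℂ) (torusEnd Φ I hφ hadd a).hom.hom.hom).comp (contMap Φ I hφ) :=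
    ContinuousMap.ext fun t => torusEnd_spec Φ I hφ hadd a t
  have hfun : singularCohomology.map ℚ ℚ (contMap Φ I hφ) 1
      (bettiCohomology.map (torusEnd Φ I hφ hadd a).hom.hom.hom 1 x) =
      singularCohomology.map ℚ ℚ fM 1 (singularCohomology.map ℚ ℚ (contMap Φ I hφ) 1 x) := by
    change (singularCohomology.map ℚ ℚ
        (AlgPoints.mapContinuous (L := ℂ) (torusEnd Φ I hφ hadd a).hom.hom.hom) 1 ≫
        singularCohomology.map ℚ ℚ (contMap Φ I hφ) 1) x =
      (singularCohomology.map ℚ ℚ (contMap Φ I hφ) 1 ≫ singularCohomology.map ℚ ℚ fM 1) x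
    rw [← singularCohomology.map_comp, ← singularCohomology.map_comp, hcomm]
  have h2 : singularCohomology.map ℚ ℚ (contMap Φ I hφ) 1 x =
      (latticeCoordHOne (periodIso Φ I)).symm (coord Φ I hφ x) := by
    rw [coord_apply, LinearEquiv.symm_apply_apply]
  rw [h1, coord_apply, hfun, h2,
    latticeCoordHOne_map_mapMatrix (periodIso Φ I) (periodIso Φ I) (mulMatrix I a) fM (fun _ => rfl)]

/-! ### §3 The period row of the coordinate functional `z ↦ z_σ`, `σ ∈ Φ` -/

/-- The `ℂ`-linear coordinate functional `z ↦ z_σ` on `ℂ^Φ` (`σ ∈ Φ`): the analytic representation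
`S(a) = diag(a^ψ)` acts on it by `σ(a)` (Shimura §5.2: `δι(α)ω_i = α^{φ_i}ω_i`).
[cite: Shimura1998, §5.2 (pp. 38–39)] -/
abbrev coordFunctional {σ : K →+* ℂ} (hσ : σ ∈ Φ.1) : (Φ.1 → ℂ) →L[ℂ] ℂ :=
  ContinuousLinearMap.proj (R := ℂ) (φ := fun _ : Φ.1 => ℂ) ⟨σ, hσ⟩

/-- **The period row of `z ↦ z_σ`** in `ℂ ⊗_ℚ ℚ^ι = H¹(T; ℂ)` (lattice coordinates).
[cite: LangeBirkenhake1992, §1.1.5 Thm. 1.1.21 (b)] -/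
def projRow {σ : K →+* ℂ} (hσ : σ ∈ Φ.1) : ℂ ⊗[ℚ] (basisIndex I → ℚ) :=
  periodRow (periodIso Φ I) ((coordFunctional Φ hσ).toLinearMap.restrictScalars ℝ)

/-- `projRow = Σᵢ σ(βᵢ) ⊗ eᵢ`: the period row of `z ↦ z_σ` is `(σ(βᵢ))ᵢ` since `v(βᵢ)_σ = σ(βᵢ)`.
[cite: Shimura1998, §6.2 Thm. 3, p. 42] -/
theorem projRow_eq_sum {σ : K →+* ℂ} (hσ : σ ∈ Φ.1) :
    projRow Φ I hσ = ∑ i, (σ (basisOfFractionalIdeal K I i) : ℂ) ⊗ₜ[ℚ] Pi.single i (1 : ℚ) := by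
  rw [projRow, periodRow_apply]
  refine Finset.sum_congr rfl fun i _ => ?_
  rw [periodIso_single]
  rfl

/-- The period row of `z ↦ z_σ` is a `(1,0)`-row (`Ω ⊆ H^{1,0}`). [cite: LangeBirkenhake1992, §1.1.5 Thm. 1.1.21 (b)] -/
theorem projRow_mem_hodgeOneZeroRows {σ : K →+* ℂ} (hσ : σ ∈ Φ.1) :
    projRow Φ I hσ ∈ hodgeOneZeroRows (periodIso Φ I) :=
  periodRow_mem_hodgeOneZeroRows (periodIso Φ I) (coordFunctional Φ hσ)

/-- The period row of `z ↦ z_σ` is non-zero (`z ↦ z_σ` is a non-zero functional and `periodRow`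
is injective). [cite: LangeBirkenhake1992, §1.1.5 Thm. 1.1.21 (b)] -/
theorem projRow_ne_zero {σ : K →+* ℂ} (hσ : σ ∈ Φ.1) : projRow Φ I hσ ≠ 0 := by
  intro h
  rw [projRow, ← (periodRow (periodIso Φ I)).map_zero] at h
  have h1 := periodRow_injective (periodIso Φ I) h
  have h2 := LinearMap.congr_fun h1 (Pi.single (⟨σ, hσ⟩ : Φ.1) (1 : ℂ))
  simp only [LinearMap.coe_restrictScalars, ContinuousLinearMap.coe_coe, ContinuousLinearMap.proj_apply,
    Pi.single_eq_same, LinearMap.zero_apply] at h2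
  exact one_ne_zero h2

omit [NumberField K] in
/-- The base change of `y ↦ N y` on `ℂ ⊗_ℚ ℚ^ι` acts on rows `Σᵢ zᵢ ⊗ eᵢ` by `z ↦ N z`.
[cite: LangeBirkenhake1992, §1.1.2] -/
private theorem baseChange_mulVecLin_sum_tmul {ι : Type} [Fintype ι] (N : Matrix ι ι ℚ)
    (z : ι → ℂ) :
    (Matrix.mulVecLin N).baseChange ℂ (∑ i, z i ⊗ₜ[ℚ] Pi.single i (1 : ℚ)) =
      ∑ i', (∑ i, (N i' i : ℂ) * z i) ⊗ₜ[ℚ] Pi.single i' (1 : ℚ) := by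
  have hcol : ∀ i, (N.col i : ι → ℚ) = ∑ i', N i' i • Pi.single i' (1 : ℚ) := fun i => by
    funext i'
    simp only [Matrix.col_apply, Finset.sum_apply, Pi.smul_apply, Pi.single_apply, smul_eq_mul,
      mul_ite, mul_one, mul_zero, Finset.sum_ite_eq, Finset.mem_univ, if_true]
  rw [map_sum]
  simp only [LinearMap.baseChange_tmul, Matrix.mulVecLin_apply, Matrix.mulVec_single_one, hcol,
    TensorProduct.tmul_sum, TensorProduct.tmul_smul, TensorProduct.smul_tmul']
  rw [Finset.sum_comm]
  refine Finset.sum_congr rfl fun i' _ => ?_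
  rw [TensorProduct.sum_tmul]
  refine Finset.sum_congr rfl fun i _ => ?_
  rw [Rat.smul_def]

/-- **`projRow` is a `σ`-eigenrow of every transposed rational representation**:
`(mulMatrix I a)ᵀ ⊗ ℂ` acts on `(σ(βᵢ))ᵢ` by `σ(a)`, because `a βᵢ = Σⱼ Mⱼᵢ βⱼ`
(`CMTypeLattice.mul_basis_eq_sum`). [cite: Shimura1998, §6.2 Thm. 3, p. 42] -/
theorem baseChange_transpose_mulMatrix_projRow {σ : K →+* ℂ} (hσ : σ ∈ Φ.1) (a : 𝓞 K) :
    (Matrix.mulVecLin ((mulMatrix I a).transpose.map (Int.cast : ℤ → ℚ))).baseChange ℂ (projRow Φ I hσ) =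
      σ (a : K) • projRow Φ I hσ := by
  rw [projRow_eq_sum, baseChange_mulVecLin_sum_tmul, Finset.smul_sum]
  refine Finset.sum_congr rfl fun i' _ => ?_
  rw [TensorProduct.smul_tmul', smul_eq_mul, ← map_mul, mul_basis_eq_sum I a i', map_sum]
  congr 1
  refine Finset.sum_congr rfl fun i _ => ?_
  rw [Matrix.map_apply, Matrix.transpose_apply, ← Int.cast_smul_eq_zsmul K, smul_eq_mul, map_mul,
    map_intCast]
  push_cast
  ring

/-! ### §4 A non-zero `σ`-eigenvector of type `(1,0)` for every `σ ∈ Φ` -/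

/-- `coord ⊗ ℂ : ℂ ⊗_ℚ H¹(A(ℂ); ℚ) ≅ ℂ ⊗_ℚ ℚ^ι = H¹(T; ℂ)`. [cite: LangeBirkenhake1992, §1.1.3 Lemma 1.1.17] -/
abbrev coordC : ℂ ⊗[ℚ] bettiCohomology A.X 1 ≃ₗ[ℂ] ℂ ⊗[ℚ] (basisIndex I → ℚ) :=
  (coord Φ I hφ).baseChange ℚ ℂ (bettiCohomology A.X 1) (basisIndex I → ℚ)

/-- **`coord ⊗ ℂ` intertwines `(ι a)^* ⊗ ℂ` with `(mulMatrix I a)ᵀ ⊗ ℂ`** (base change of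
`coord_hOneAlgHom`). [cite: LangeBirkenhake1992, §1.1.2 eq. (1.2) and §1.1.3 Lemma 1.1.17 (a)] -/
theorem coordC_hOneAlgHom_baseChange (a : 𝓞 K) (x : ℂ ⊗[ℚ] bettiCohomology A.X 1) :
    coordC Φ I hφ ((hOneAlgHom (torusEndAlgebra Φ I hφ hadd) (a : K)).baseChange ℂ x) =
      (Matrix.mulVecLin ((mulMatrix I a).transpose.map (Int.cast : ℤ → ℚ))).baseChange ℂ
        (coordC Φ I hφ x) := by
  have hcomp : (coord Φ I hφ).toLinearMap ∘ₗ
      (hOneAlgHom (torusEndAlgebra Φ I hφ hadd) (a : K) : bettiCohomology A.X 1 →ₗ[ℚ] _) =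
      Matrix.mulVecLin ((mulMatrix I a).transpose.map (Int.cast : ℤ → ℚ)) ∘ₗ
        (coord Φ I hφ).toLinearMap :=
    LinearMap.ext fun y => coord_hOneAlgHom Φ I hφ hadd a y
  change (coord Φ I hφ).toLinearMap.baseChange ℂ _ = _
  rw [← LinearMap.comp_apply, ← LinearMap.baseChange_comp, hcomp, LinearMap.baseChange_comp,
    LinearMap.comp_apply]
  rfl

/-- **The `(1,0)`-classes of `A` in canonical lattice coordinates are the `(1,0)`-rows**
(`complexTorus_latticeCoordHOne_hodgeOneZero_holds` through `coord`).
[cite: LangeBirkenhake1992, §1.1.5 Thm. 1.1.21 (b)] -/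
theorem mem_piece_one_zero_iff (hHD : exists_isReal_hodgeModel) (hI : hodgePQ_independent_of_hodgeModel)
    (x : ℂ ⊗[ℚ] bettiCohomology A.X 1) :
    x ∈ (BettiUniverse.hodge hHD (AbelianVariety.isSmoothProjective_holds (A := A)) 1).piece 1 0 ↔
      coordC Φ I hφ x ∈ hodgeOneZeroRows (periodIso Φ I) := by
  rw [BettiUniverse.mem_hodge_piece_one_zero_iff hHD hI,
    complexTorus_latticeCoordHOne_hodgeOneZero_holds (periodIso Φ I)
      (AbelianVariety.isSmoothProjective_holds (A := A)) (contMap Φ I hφ) hφ x,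
    ← coord_toLinearMap]
  rfl

/-- The `(1,0)`-eigenvector: `x_σ = (coord ⊗ ℂ)⁻¹ (projRow σ)`. [cite: Shimura1998, §5.2 (pp. 38–39)] -/
def eigenvector {σ : K →+* ℂ} (hσ : σ ∈ Φ.1) : ℂ ⊗[ℚ] bettiCohomology A.X 1 :=
  (coordC Φ I hφ).symm (projRow Φ I hσ)

/-- `(coord ⊗ ℂ) x_σ = projRow σ`. [folklore] -/
@[simp] private theorem coordC_eigenvector {σ : K →+* ℂ} (hσ : σ ∈ Φ.1) :
    coordC Φ I hφ (eigenvector Φ I hφ hσ) = projRow Φ I hσ :=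
  LinearEquiv.apply_symm_apply _ _

/-- The eigen-equation on `𝓞_K`: `((ι a)^* ⊗ ℂ) x_σ = σ(a) x_σ`. [cite: Shimura1998, §5.2 (pp. 38–39)] -/
theorem hOneAlgHom_baseChange_eigenvector_integer {σ : K →+* ℂ} (hσ : σ ∈ Φ.1) (a : 𝓞 K) :
    (hOneAlgHom (torusEndAlgebra Φ I hφ hadd) (a : K)).baseChange ℂ (eigenvector Φ I hφ hσ) =
      σ (a : K) • eigenvector Φ I hφ hσ := by
  apply (coordC Φ I hφ).injective
  rw [coordC_hOneAlgHom_baseChange, coordC_eigenvector, baseChange_transpose_mulMatrix_projRow,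
    map_smul, coordC_eigenvector]

/-- **From `𝓞_K` to `K`**: an eigen-equation for the integral action extends to `K = ℚ · 𝓞_K`
(`(ι e)^*` is `ℚ`-linear and multiplicative in `e`; clear the denominator).
[cite: Shimura1998, §6.2 Thm. 3, pp. 41–42] -/
theorem hOneAlgHom_baseChange_eq_smul_of_integer {σ : K →+* ℂ} {x : ℂ ⊗[ℚ] bettiCohomology A.X 1}
    (h : ∀ a : 𝓞 K, (hOneAlgHom (torusEndAlgebra Φ I hφ hadd) (a : K)).baseChange ℂ x = σ (a : K) • x)
    (e : K) : (hOneAlgHom (torusEndAlgebra Φ I hφ hadd) e).baseChange ℂ x = σ e • x := by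
  set ψ := torusEndAlgebra Φ I hφ hadd with hψ
  obtain ⟨⟨a, _, d, hd, rfl⟩, hea⟩ := IsLocalization.surj (Algebra.algebraMapSubmonoid (𝓞 K) ℤ⁰) e
  have hd0 : (d : ℂ) ≠ 0 := Int.cast_ne_zero.2 (nonZeroDivisors.ne_zero hd)
  -- `e * d = a` in `K`
  have hea' : e * (d : K) = (a : K) := by
    have : (algebraMap (𝓞 K) K) (algebraMap ℤ (𝓞 K) d) = (d : K) := by
      rw [eq_intCast, map_intCast]
    rw [← this]; exact hea
  -- `(ι d)^* ⊗ ℂ = d •`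
  have hdK : (d : K) = algebraMap ℚ K (d : ℚ) := by rw [map_intCast]
  have hTd : ∀ y : ℂ ⊗[ℚ] bettiCohomology A.X 1,
      (hOneAlgHom ψ (d : K)).baseChange ℂ y = (d : ℂ) • y := fun y => by
    rw [hdK, AlgHom.commutes, Algebra.algebraMap_eq_smul_one, LinearMap.baseChange_smul,
      LinearMap.smul_apply, Module.End.one_eq_id, LinearMap.baseChange_id, LinearMap.id_apply,
      ← algebraMap_smul ℂ ((d : ℤ) : ℚ) y, map_intCast]
  -- `(ι a)^* = (ι e)^* ∘ (ι d)^*`, so `d • (ι e)^* x = σ(a) x = d • σ(e) x`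
  have hTa : (hOneAlgHom ψ (a : K)).baseChange ℂ x = (d : ℂ) • (hOneAlgHom ψ e).baseChange ℂ x := by
    rw [← hea', map_mul, Module.End.mul_eq_comp, LinearMap.baseChange_comp, LinearMap.comp_apply, hTd,
      map_smul]
  have key : (d : ℂ) • (hOneAlgHom ψ e).baseChange ℂ x = (d : ℂ) • (σ e • x) := by
    rw [← hTa, h a, ← hea', map_mul, map_intCast, mul_comm, mul_smul]
  have := congrArg (fun y => (d : ℂ)⁻¹ • y) key
  simpa only [smul_smul, ← mul_assoc, inv_mul_cancel₀ hd0, one_mul, one_smul] using this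

/-- **For every `σ ∈ Φ` there is a non-zero `σ`-eigenvector of the `K`-action in `H^{1,0}(A)`**
(Shimura §5.2: the invariant differential `ω_i` with `δι(α)ω_i = α^{φ_i}ω_i`; here the class of
`dz_σ` read on `H¹(A(ℂ); ℚ) ⊗ ℂ`). [cite: Shimura1998, §5.2 (pp. 38–39), §6.2 Thm. 3 (p. 42)] -/
theorem exists_eigenvector_one_zero (hHD : exists_isReal_hodgeModel)
    (hI : hodgePQ_independent_of_hodgeModel) {σ : K →+* ℂ} (hσ : σ ∈ Φ.1) :
    ∃ x ∈ (hOneEndAction (torusEndAlgebra Φ I hφ hadd) hHD hI).eigenPiece σ 1 0, x ≠ 0 := by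
  refine ⟨eigenvector Φ I hφ hσ, ?_, fun h => projRow_ne_zero Φ I hσ ?_⟩
  · rw [EndAction.mem_eigenPiece_iff]
    refine ⟨(mem_piece_one_zero_iff Φ I hφ hHD hI _).2 ?_, fun e => ?_⟩
    · rw [coordC_eigenvector]
      exact projRow_mem_hodgeOneZeroRows Φ I hσ
    · rw [hOneEndAction_ι]
      exact hOneAlgHom_baseChange_eq_smul_of_integer Φ I hφ hadd
        (hOneAlgHom_baseChange_eigenvector_integer Φ I hφ hadd hσ) e
  · rw [← coordC_eigenvector Φ I hφ hσ, h, map_zero]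

/-! ### §5 The CM type read on `H^{1,0}` is `Φ` -/

/-- `n_σ ≥ 1` for `σ ∈ Φ`. [cite: Shimura1998, §5.2 (pp. 36–39)] -/
theorem multiplicity_pos (hHD : exists_isReal_hodgeModel) (hI : hodgePQ_independent_of_hodgeModel)
    {σ : K →+* ℂ} (hσ : σ ∈ Φ.1) :
    0 < (hOneEndAction (torusEndAlgebra Φ I hφ hadd) hHD hI).multiplicity σ := by
  haveI : FiniteDimensional ℚ (bettiCohomology A.X 1) := finite_bettiCohomology_one A
  obtain ⟨x, hx, hx0⟩ := exists_eigenvector_one_zero Φ I hφ hadd hHD hI hσ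
  change 0 < Module.finrank ℂ _
  rw [Module.finrank_pos_iff_exists_ne_zero]
  exact ⟨⟨x, hx⟩, fun h => hx0 (congrArg Subtype.val h)⟩

/-- **The CM type of `(A, ι)` read on `H^{1,0}(A)` is `Φ`** («`(A, ι)` is of type `(F; {φ_i})`»):
`n_σ ≥ 1` for `σ ∈ Φ` (`multiplicity_pos`) and `n_σ + n_σ̄ = 1`
(`multiplicity_add_multiplicity_conjugate_eq_one`, `[K : ℚ] = 2 dim A`), while `Φ` contains
exactly one of `σ, σ̄`. [cite: Shimura1998, §6.2 Thm. 3 (pp. 41–42), §5.2 (pp. 36–39)]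
[cite: Deligne1982HodgeCycles, Example 3.7] -/
theorem cmType_eq (hHD : exists_isReal_hodgeModel) (hI : hodgePQ_independent_of_hodgeModel) :
    (hOneEndAction (torusEndAlgebra Φ I hφ hadd) hHD hI).cmType = Φ.1 := by
  have hK : Module.finrank ℚ K = 2 * A.dim := by
    rw [dim_eq_card Φ I hφ, CMTypeLattice.two_mul_card_eq_finrank]
  ext σ
  rw [EndAction.mem_cmType_iff]
  have hsum := multiplicity_add_multiplicity_conjugate_eq_one (torusEndAlgebra Φ I hφ hadd) hK hHD hI σ
  constructor
  · intro h1
    by_contra hσ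
    have hσ' : ComplexEmbedding.conjugate σ ∈ Φ.1 := by
      have := (Φ.2 (ComplexEmbedding.conjugate σ)).2
      rw [show ComplexEmbedding.conjugate (ComplexEmbedding.conjugate σ) = σ from
        ComplexEmbedding.involutive_conjugate K σ] at this
      exact this hσ
    have hpos := multiplicity_pos Φ I hφ hadd hHD hI hσ'
    omega
  · intro hσ
    have hpos := multiplicity_pos Φ I hφ hadd hHD hI hσ
    omega

/-! ### §6 The realisation of `(K; Φ)` on `H¹` -/

/-- **The algebraised CM torus realises the CM type `(K; Φ)` on `H¹`** (Shimura §6.2 THEOREM 3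
with §5.2 and §3.2; the pair `(A, torusEnd)` is principal for the `𝓞_K`-ideal `I`, so no
principalisation is needed): all clauses of `IsCMTypeRealisation Φ A torusEnd (complexAction ·)`
by `isCMTypeRealisation_of_principal_of_cmType` over `cmType_eq` and `[K : ℚ] = 2 dim A`, the Hodge
records being the kernel theorems `exists_isReal_hodgeModel_holds`,
`hodgePQ_independent_of_hodgeModel_holds`. [cite: Shimura1998, §6.2 Thm. 3 (pp. 41–42), §5.2 (pp. 36–39), §3.2 (pp. 19–20)] -/
theorem isCMTypeRealisation :
    IsCMTypeRealisation Φ A (torusEnd Φ I hφ hadd)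
      (complexAction (torusEndAlgebra Φ I hφ hadd)) :=
  isCMTypeRealisation_of_principal_of_cmType (torusEndAlgebra Φ I hφ hadd)
    (by rw [dim_eq_card Φ I hφ, CMTypeLattice.two_mul_card_eq_finrank])
    exists_isReal_hodgeModel_holds hodgePQ_independent_of_hodgeModel_holds
    (torusEnd Φ I hφ hadd) (fun a => torusEndAlgebra_algebraMap Φ I hφ hadd a) Φ
    (cmType_eq Φ I hφ hadd _ _).symm

include I hφ hadd in
/-- **Shimura §6.2 Thm. 3 for an algebraised CM torus, as the `∃`-clause of the record
`PicardCM.CMAbelianVarietyRealised` at `(K, Φ)`**: if the torus `ℂ^Φ/D(I)` is the analytification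
of a complex abelian variety `A` (as a group), then `A` carries `ι : 𝓞_K → End A` and
`θ : K → End_ℂ H¹(A(ℂ); ℂ)` realising `(K; Φ)` on `H¹`. [cite: Shimura1998, §6.2 Thm. 3 (pp. 41–42)] -/
theorem exists_isCMTypeRealisation :
    ∃ (ι : 𝓞 K →+* End A) (θ : K →+* Module.End ℂ (complexBetti A.X 1)), IsCMTypeRealisation Φ A ι θ :=
  ⟨_, _, isCMTypeRealisation Φ I hφ hadd⟩

end CMTorusRealisation

end Literature.AlgebraicGeometry.ComplexMultiplication

end
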